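import Mathlib
import Summits.ValiantsHypothesis.ValiantsHypothesis.Theorems.RigidityForcesSymmetryRankRigidMinimalReprLaplaceDual

/-!
# The triangular witness lemma for the functional dual of `LaplaceOptimal`
# (crux `RankRigidMinimalRepr`, stmt-ValiantsHypothesis-18034; frontier rung `LaplaceOptimalFive`, stmt-24813)

`…LaplaceDual.lean` reduces the refutation of a purported split-rank-one decomposition of the permutation pattern to
exhibiting a covector tuple `φ = (φ_i)_i` that KILLS every term (a slice at slot `i` with vector `α`: `φ_i ⊥ α`; a
pair term on the slots `p, q` with matrix `g`: `Σ_{a,b} φ_p(a) g(a,b) φ_q(b) = 0`) and has `per (φ_i(c))_{c,i} ≠ 0`.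

`triangular_witness` CONSTRUCTS such a tuple greedily along an order of the slots whenever a COUNT hypothesis holds:
at position `j` the slot `s = ord j` carries `|A_s|` slice vectors, one more linear condition if `s = q` is the later
endpoint of the pair (the earlier endpoint's covector is already fixed), and `j` conditions "vanish on the pivot columns
of the earlier slots"; if `|A_s| + [s = q] + j ≤ n - 1` at every position, a non-zero solution exists at every step
(`exists_ne_zero_orthogonal`: fewer than `n` homogeneous linear conditions in `ℂⁿ`), its pivot is a coordinate where it
is non-zero, and the resulting matrix is TRIANGULAR with non-zero diagonal along (order, pivots), so its permanent is the
product of the pivots (`permanent_eq_prod_of_triangular`).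

General `n`; no new definitions.  Used at `n = 5` by `…LaplaceFiveFourSlices.lean` (the slice classes `a = 4` of
`LaplaceOptimalFive`).  HONEST FRAMING: infrastructure for the frontier rung `LaplaceOptimalFive` (stmt-24813), which
stays OPEN; nothing here bears on `VP ≠ VNP`.
-/

set_option autoImplicit false

-- the mandated summit-side namespace repeats a component by design (single-problem summit)
set_option linter.dupNamespace false

namespace Summit.ValiantsHypothesis.ValiantsHypothesis.Theorems.RigidityForcesSymmetryRankRigidMinimalRepr

namespace LaplaceTriangular

open Finset Module

variable {n : ℕ}

/-! ### §1 Fewer than `n` homogeneous linear conditions in `ℂⁿ` have a non-zero solution -/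

/-- A finite set of fewer than `n` vectors in `ℂⁿ` has a non-zero common "orthogonal" vector (for the bilinear pairing
`Σ_c φ(c) a(c)`). -/
theorem exists_ne_zero_orthogonal (T : Finset (Fin n → ℂ)) (hT : T.card < n) :
    ∃ φ : Fin n → ℂ, φ ≠ 0 ∧ ∀ a ∈ T, ∑ c, φ c * a c = 0 := by
  classical
  let f : (Fin n → ℂ) →ₗ[ℂ] (T → ℂ) :=
    { toFun := fun φ a => ∑ c, φ c * (a : Fin n → ℂ) c
      map_add' := fun φ ψ => by funext a; simp [add_mul, sum_add_distrib]
      map_smul' := fun r φ => by funext a; simp [mul_assoc, mul_sum] }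
  have hlt : finrank ℂ (T → ℂ) < finrank ℂ (Fin n → ℂ) := by
    rw [finrank_fintype_fun_eq_card, finrank_fintype_fun_eq_card, Fintype.card_coe, Fintype.card_fin]
    exact hT
  have hker := LinearMap.ker_ne_bot_of_finrank_lt (f := f) hlt
  obtain ⟨φ, hφ, hne⟩ := (Submodule.ne_bot_iff _).mp hker
  refine ⟨φ, hne, fun a ha => ?_⟩
  have := congrFun (LinearMap.mem_ker.mp hφ) ⟨a, ha⟩
  simpa [f] using this

/-! ### §2 The permanent of a triangular matrix -/

/-- **Triangular permanent.**  If the rows (slots) are ranked by an injective `pos`, each slot `i` has a pivot column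
`τ i` (`τ` a bijection) with `φ_i(τ i) ≠ 0`… more precisely: if `φ_i(τ i') = 0` whenever `pos i' < pos i`, then
`per (φ_i(c))_{c,i} = Π_i φ_i(τ i)`. -/
theorem permanent_eq_prod_of_triangular (φ : Fin n → Fin n → ℂ) (τ : Equiv.Perm (Fin n)) (pos : Fin n → ℕ)
    (hpos : Function.Injective pos) (htri : ∀ i i', pos i' < pos i → φ i (τ i') = 0) :
    (Matrix.of fun c i => φ i c).permanent = ∏ i, φ i (τ i) := by
  classical
  unfold Matrix.permanent
  rw [sum_eq_single τ]
  · simp [Matrix.of_apply]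
  · intro σ _ hστ
    simp only [Matrix.of_apply]
    -- `π := τ⁻¹ ∘ σ`; if `pos (π i) ≥ pos i` for all `i` then `π = id`, i.e. `σ = τ`
    set π : Equiv.Perm (Fin n) := σ.trans τ.symm with hπ
    have hτπ : ∀ i, τ (π i) = σ i := fun i => by simp [hπ]
    by_contra hprod
    have hall : ∀ i, φ i (σ i) ≠ 0 := fun i h => hprod (prod_eq_zero (mem_univ i) h)
    have hge : ∀ i ∈ (univ : Finset (Fin n)), pos i ≤ pos (π i) := by
      intro i _
      by_contra hlt
      push Not at hlt
      have := htri i (π i) hlt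
      rw [hτπ] at this
      exact hall i this
    have hsum : ∑ i, pos (π i) = ∑ i, pos i := Equiv.sum_comp π pos
    have heq := (sum_eq_sum_iff_of_le hge).mp hsum.symm
    apply hστ
    ext i
    have h1 : i = π i := hpos (heq i (mem_univ i))
    have h2 := hτπ i
    rw [← h1] at h2
    exact congrArg Fin.val h2.symm
  · intro h; exact absurd (mem_univ τ) h

/-! ### §3 The greedy construction -/

/-- **Triangular witness lemma.**  Slots `Fin n` processed in the order `ord` (position `j ↦` slot `ord j`); slice
vectors `A s` at slot `s`; one pair term on slots `p ≠ q` with matrix `g`, `p` processed before `q`.  If at every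
position `j` the count `|A (ord j)| + [ord j = q] + j ≤ n - 1` holds, there is a covector tuple `φ` killing every slice
(`Σ_c φ_s(c) a(c) = 0` for `a ∈ A s`) and the pair (`Σ_{a,b} φ_p(a) φ_q(b) g(a,b) = 0`) with `per (φ_i(c))_{c,i} ≠ 0`. -/
theorem triangular_witness (ord : Equiv.Perm (Fin n)) (A : Fin n → Finset (Fin n → ℂ)) (p q : Fin n)
    (hpq : ord.symm p < ord.symm q) (g : Fin n → Fin n → ℂ)
    (hcount : ∀ j : Fin n, (A (ord j)).card + (if ord j = q then 1 else 0) + (j : ℕ) + 1 ≤ n) :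
    ∃ φ : Fin n → Fin n → ℂ,
      (∀ s, ∀ a ∈ A s, ∑ c, φ s c * a c = 0) ∧
      (∑ ab : Fin n × Fin n, φ p ab.1 * φ q ab.2 * g ab.1 ab.2 = 0) ∧
      (Matrix.of fun c i => φ i c).permanent ≠ 0 := by
  classical
  have hpq' : p ≠ q := fun h => by rw [h] at hpq; exact lt_irrefl _ hpq
  -- INVARIANT after `j` steps: covectors on the slots `ord m`, `m < j`, with pivots `c m`
  have step : ∀ j : ℕ, j ≤ n → ∃ (φ : Fin n → Fin n → ℂ) (c : Fin n → Fin n),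
      (∀ m : Fin n, (m : ℕ) < j →
        (∀ a ∈ A (ord m), ∑ x, φ (ord m) x * a x = 0) ∧
        (ord m = q → ∑ ab : Fin n × Fin n, φ p ab.1 * φ q ab.2 * g ab.1 ab.2 = 0) ∧
        φ (ord m) (c m) ≠ 0 ∧
        (∀ l : Fin n, l < m → φ (ord m) (c l) = 0)) ∧
      (∀ m m' : Fin n, (m : ℕ) < j → (m' : ℕ) < j → c m = c m' → m = m') := by
    intro j
    induction j with
    | zero => intro _; exact ⟨fun _ _ => 0, fun m => m, by simp, by simp⟩
    | succ j ih =>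
      intro hj
      obtain ⟨φ, c, hinv, hinj⟩ := ih (by omega)
      -- the new slot
      set jf : Fin n := ⟨j, by omega⟩ with hjf
      set s : Fin n := ord jf with hs
      -- its constraints: slices, the pair row if `s = q`, the earlier pivots
      let pairRow : Fin n → ℂ := fun b => ∑ a, φ p a * g a b
      let T : Finset (Fin n → ℂ) :=
        A s ∪ (if s = q then {pairRow} else ∅) ∪ (univ.filter (fun l : Fin n => l < jf)).image (fun l => Pi.single (c l) 1)
      have hT : T.card < n := by
        have hIio : (univ.filter (fun l : Fin n => l < jf)) = Finset.Iio jf := by ext l; simp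
        have h1 : T.card ≤ (A s).card + (if s = q then 1 else 0) + j := by
          refine (card_union_le _ _).trans ?_
          refine (Nat.add_le_add_right (card_union_le _ _) _).trans ?_
          refine Nat.add_le_add (Nat.add_le_add_left ?_ _) ?_
          · split_ifs <;> simp
          · refine card_image_le.trans ?_
            rw [hIio, Fin.card_Iio]
        have h2 := hcount jf
        have hjv : (jf : ℕ) = j := rfl
        rw [← hs, hjv] at h2
        omega
      obtain ⟨ψ, hψ0, hψ⟩ := exists_ne_zero_orthogonal T hT
      obtain ⟨cj, hcj⟩ : ∃ x, ψ x ≠ 0 := by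
        by_contra h; push Not at h; exact hψ0 (funext h)
      -- orthogonality consequences
      have hψA : ∀ a ∈ A s, ∑ x, ψ x * a x = 0 := fun a ha => hψ a (by simp [T, ha])
      have hψq : s = q → ∑ x, ψ x * pairRow x = 0 := fun hsq => hψ pairRow (by simp [T, hsq])
      have hψc : ∀ l : Fin n, l < jf → ψ (c l) = 0 := by
        intro l hl
        have := hψ (Pi.single (c l) 1) (by
          simp only [T, mem_union, mem_image, mem_filter, mem_univ, true_and]
          exact Or.inr ⟨l, hl, rfl⟩)
        simpa [Pi.single_apply] using this
      -- extend
      refine ⟨Function.update φ s ψ, Function.update c jf cj, ?_, ?_⟩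
      · intro m hm
        rcases Nat.lt_succ_iff_lt_or_eq.mp hm with hm' | hm'
        · -- an earlier slot: unchanged
          have hmj : m ≠ jf := fun h => by rw [h] at hm'; exact lt_irrefl _ hm'
          have hms : ord m ≠ s := fun h => hmj (ord.injective (h.trans hs))
          obtain ⟨h1, h2, h3, h4⟩ := hinv m hm'
          refine ⟨?_, ?_, ?_, ?_⟩
          · intro a ha
            rw [Function.update_of_ne hms]
            exact h1 a ha
          · intro hmq
            -- `p` and `q = ord m` are earlier slots, both `≠ s`
            have hps : p ≠ s := by
              intro h
              have e1 : ord.symm p = jf := by rw [h, hs, Equiv.symm_apply_apply]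
              have e2 : ord.symm q = m := by rw [← hmq, Equiv.symm_apply_apply]
              have := hpq
              rw [e1, e2, Fin.lt_def] at this
              exact absurd (lt_trans this hm') (lt_irrefl _)
            have hqs : q ≠ s := by rw [← hmq]; exact hms
            rw [Function.update_of_ne hps, Function.update_of_ne hqs]
            exact h2 hmq
          · rw [Function.update_of_ne hms, Function.update_of_ne hmj]
            exact h3
          · intro l hl
            have hlj : l ≠ jf := by
              intro h; rw [h, Fin.lt_def] at hl
              exact absurd (lt_trans hl hm') (lt_irrefl _)
            rw [Function.update_of_ne hms, Function.update_of_ne hlj]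
            exact h4 l hl
        · -- the new slot `m = jf`
          have hmj : m = jf := Fin.ext hm'
          have hom : ord m = s := by rw [hmj, hs]
          refine ⟨?_, ?_, ?_, ?_⟩
          · intro a ha
            rw [hom, Function.update_self]
            rw [hom] at ha
            exact hψA a ha
          · intro hq
            rw [hom] at hq
            -- `p` is an earlier slot, so its covector is the old one
            have hps : p ≠ s := fun h => hpq' (h.trans hq)
            have hsq : Function.update φ s ψ q = ψ := by rw [← hq, Function.update_self]
            have hsp : Function.update φ s ψ p = φ p := Function.update_of_ne hps _ _
            rw [hsq, hsp, Fintype.sum_prod_type, Finset.sum_comm]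
            have := hψq hq
            simp only [pairRow] at this
            rw [← this]
            refine sum_congr rfl fun b _ => ?_
            rw [mul_sum]
            exact sum_congr rfl fun a _ => by ring
          · rw [hom, hmj, Function.update_self, Function.update_self]
            exact hcj
          · intro l hl
            have hlj : l ≠ jf := by
              intro h; rw [h, hmj] at hl; exact lt_irrefl _ hl
            rw [hom, Function.update_self, Function.update_of_ne hlj]
            exact hψc l (by rw [hmj] at hl; exact hl)
      · -- injectivity of the pivots
        intro m m' hm hm' hcc
        rcases Nat.lt_succ_iff_lt_or_eq.mp hm with h1 | h1 <;> rcases Nat.lt_succ_iff_lt_or_eq.mp hm' with h2 | h2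
        · have hmj : m ≠ jf := fun h => by rw [h] at h1; exact lt_irrefl _ h1
          have hmj' : m' ≠ jf := fun h => by rw [h] at h2; exact lt_irrefl _ h2
          rw [Function.update_of_ne hmj, Function.update_of_ne hmj'] at hcc
          exact hinj m m' h1 h2 hcc
        · have hmj : m ≠ jf := fun h => by rw [h] at h1; exact lt_irrefl _ h1
          have hm'j : m' = jf := Fin.ext h2
          rw [Function.update_of_ne hmj, hm'j, Function.update_self] at hcc
          have hlt : m < jf := by rw [Fin.lt_def]; exact h1
          exact absurd (hψc m hlt) (by rw [hcc]; exact hcj)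
        · have hm'j : m' ≠ jf := fun h => by rw [h] at h2; exact lt_irrefl _ h2
          have hmj : m = jf := Fin.ext h1
          rw [Function.update_of_ne hm'j, hmj, Function.update_self] at hcc
          have hlt : m' < jf := by rw [Fin.lt_def]; exact h2
          exact absurd (hψc m' hlt) (by rw [← hcc]; exact hcj)
        · exact Fin.ext (by rw [h1, h2])
  -- all `n` slots processed
  obtain ⟨φ, c, hinv, hinj⟩ := step n le_rfl
  have hcinj : Function.Injective c := fun m m' h => hinj m m' m.isLt m'.isLt h
  let cperm : Equiv.Perm (Fin n) := Equiv.ofBijective c (Finite.injective_iff_bijective.mp hcinj)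
  refine ⟨φ, ?_, ?_, ?_⟩
  · intro s a ha
    have := (hinv (ord.symm s) (ord.symm s).isLt).1 a (by simpa using ha)
    simpa using this
  · have := (hinv (ord.symm q) (ord.symm q).isLt).2.1 (by simp)
    exact this
  · -- triangular with pivots `τ = c ∘ ord⁻¹` and ranks `pos = ord⁻¹`
    rw [permanent_eq_prod_of_triangular φ (ord.symm.trans cperm) (fun i => (ord.symm i : ℕ))
      (fun i i' h => ord.symm.injective (Fin.ext h)) ?_]
    · refine prod_ne_zero_iff.mpr fun i _ => ?_
      have := (hinv (ord.symm i) (ord.symm i).isLt).2.2.1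
      simpa [cperm] using this
    · intro i i' hlt
      have := (hinv (ord.symm i) (ord.symm i).isLt).2.2.2 (ord.symm i') (by rw [Fin.lt_def]; exact hlt)
      simpa [cperm] using this

end LaplaceTriangular

end Summit.ValiantsHypothesis.ValiantsHypothesis.Theorems.RigidityForcesSymmetryRankRigidMinimalRepr
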